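import Mathlib
import HarnessLib

/-!
# The Airy energy identity behind the fold's energy neutrality: `(x·f² − f′²)′ = f²` whenever `f″ = x·f`

Helper file (`--supports stmt-RiemannHypothesis-0098`), elementary calculus, no definitions.  Seat rh-explicit-weil-5 gen13
(file of record `HOME/rh-explicit-weil-5/WEIL5-XFOLD.md` §1(d)).

Context (documentation only).  The uniform (Airy) two-ray intensity of a fold, `2π√z·Ai(−z)²` in units of its geometric-optics
mean, carries the same integrated weight as geometric optics: `∫_{-∞}^{Z} (2πAi(−z)² − z₊^{-1/2}) dz → 0`, because
`∫ Ai(−z)² dz = z·Ai(−z)² + Ai′(−z)²` in closed form and the Airy asymptotics give `Z·Ai(−Z)² + Ai′(−Z)² ∼ √Z/π`.  The closed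
form is the case `f = Ai` of an identity that needs only the Airy EQUATION `f″(y) = y·f(y)`; Mathlib has no Airy function, so this
file proves the identity for every solution of the equation:

* `hasDerivAt_airyEnergy`      : `f″ = x f` ⇒ `d/dx (x·f(x)² − f′(x)²) = f(x)²`;
* `hasDerivAt_airyEnergy_refl` : the reflected form used at a fold, `d/dz (z·f(−z)² + f′(−z)²) = f(−z)²`;
* `integral_sq_refl_eq`        : hence `∫_A^B f(−z)² dz = [z·f(−z)² + f′(−z)²]_A^B`.

Standard axioms only; no `sorry`.
-/

set_option linter.dupNamespace false
set_option autoImplicit false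

noncomputable section

open Real MeasureTheory Set intervalIntegral

namespace Summit.RiemannHypothesis.RiemannHypothesis.Theorems.WeilFoldAiryEnergy

/-- THE AIRY ENERGY IDENTITY.  If `f′ = fd` and `fd′(x) = x·f(x)` (the Airy equation), then
`d/dx (x·f(x)² − fd(x)²) = f(x)²`. -/
theorem hasDerivAt_airyEnergy (f fd : ℝ → ℝ) (hf : ∀ x, HasDerivAt f (fd x) x)
    (hfd : ∀ x, HasDerivAt fd (x * f x) x) (x : ℝ) :
    HasDerivAt (fun y => y * f y ^ 2 - fd y ^ 2) (f x ^ 2) x := by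
  have e : (fun y => y * f y ^ 2 - fd y ^ 2) = fun y => y * (f y * f y) - fd y * fd y := by
    funext y; simp only [sq]
  have h1 : HasDerivAt (fun y => y * (f y * f y)) (1 * (f x * f x) + x * (fd x * f x + f x * fd x)) x :=
    (hasDerivAt_id' x).mul ((hf x).mul (hf x))
  have h2 : HasDerivAt (fun y => fd y * fd y) (x * f x * fd x + fd x * (x * f x)) x := (hfd x).mul (hfd x)
  rw [e]
  exact (h1.sub h2).congr_deriv (by ring)

/-- THE REFLECTED FORM (the one used at a fold caustic, where the bright side is `Ai(−z)`, `z > 0`):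
`d/dz (z·f(−z)² + fd(−z)²) = f(−z)²`. -/
theorem hasDerivAt_airyEnergy_refl (f fd : ℝ → ℝ) (hf : ∀ x, HasDerivAt f (fd x) x)
    (hfd : ∀ x, HasDerivAt fd (x * f x) x) (z : ℝ) :
    HasDerivAt (fun y => y * f (-y) ^ 2 + fd (-y) ^ 2) (f (-z) ^ 2) z := by
  -- chain rule through y ↦ −y
  have hfz : HasDerivAt (fun y => f (-y)) (fd (-z) * (-1)) z := (hf (-z)).comp z (hasDerivAt_neg z)
  have hfdz : HasDerivAt (fun y => fd (-y)) ((-z) * f (-z) * (-1)) z := (hfd (-z)).comp z (hasDerivAt_neg z)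
  have e : (fun y => y * f (-y) ^ 2 + fd (-y) ^ 2) = fun y => y * (f (-y) * f (-y)) + fd (-y) * fd (-y) := by
    funext y; simp only [sq]
  have h1 : HasDerivAt (fun y => y * (f (-y) * f (-y)))
      (1 * (f (-z) * f (-z)) + z * (fd (-z) * (-1) * f (-z) + f (-z) * (fd (-z) * (-1)))) z :=
    (hasDerivAt_id' z).mul (hfz.mul hfz)
  have h2 : HasDerivAt (fun y => fd (-y) * fd (-y))
      ((-z) * f (-z) * (-1) * fd (-z) + fd (-z) * ((-z) * f (-z) * (-1))) z := hfdz.mul hfdz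
  rw [e]
  exact (h1.add h2).congr_deriv (by ring)

/-- CLOSED-FORM ENERGY OF A FOLD'S BRIGHT SIDE: for every solution of the Airy equation and all `A, B`,
`∫_A^B f(−z)² dz = (B·f(−B)² + fd(−B)²) − (A·f(−A)² + fd(−A)²)`. -/
theorem integral_sq_refl_eq (f fd : ℝ → ℝ) (hf : ∀ x, HasDerivAt f (fd x) x)
    (hfd : ∀ x, HasDerivAt fd (x * f x) x) (A B : ℝ) :
    ∫ z in A..B, f (-z) ^ 2 = (B * f (-B) ^ 2 + fd (-B) ^ 2) - (A * f (-A) ^ 2 + fd (-A) ^ 2) := by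
  have hcont : Continuous f := continuous_iff_continuousAt.2 fun x => (hf x).continuousAt
  have hint : IntervalIntegrable (fun z => f (-z) ^ 2) volume A B :=
    ((hcont.comp continuous_neg).pow 2).intervalIntegrable A B
  exact integral_eq_sub_of_hasDerivAt (fun z _ => hasDerivAt_airyEnergy_refl f fd hf hfd z) hint

/-- The unreflected companion: `∫_A^B f(x)² dx = (B·f(B)² − fd(B)²) − (A·f(A)² − fd(A)²)`. -/
theorem integral_sq_eq (f fd : ℝ → ℝ) (hf : ∀ x, HasDerivAt f (fd x) x)
    (hfd : ∀ x, HasDerivAt fd (x * f x) x) (A B : ℝ) :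
    ∫ x in A..B, f x ^ 2 = (B * f B ^ 2 - fd B ^ 2) - (A * f A ^ 2 - fd A ^ 2) := by
  have hcont : Continuous f := continuous_iff_continuousAt.2 fun x => (hf x).continuousAt
  have hint : IntervalIntegrable (fun x => f x ^ 2) volume A B := (hcont.pow 2).intervalIntegrable A B
  exact integral_eq_sub_of_hasDerivAt (fun x _ => hasDerivAt_airyEnergy f fd hf hfd x) hint

end Summit.RiemannHypothesis.RiemannHypothesis.Theorems.WeilFoldAiryEnergy

end
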